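import Summits.PneNP.PneNP.Theses.RootDecompSegregator

/-!
# `RootDecompSegregator.EqExpRungLogGlue` (stmt-PneNP-26299) — glue of the segregator split

Node N7 of the decomp-pnenp root-decomposition cell (route `route-PneNP-RootDecompSegregator`) split its
shadow `EqExpRungLog` (stmt-PneNP-26196) into `SmallSegregators` (stmt-PneNP-26297, since refuted) and
`SegregatorLift := SmallSegregators → EqExpRungLog` (stmt-PneNP-26298).  The glue item
`SmallSegregators → SegregatorLift → EqExpRungLog` is modus ponens over the route declarations; landing
it leaves the dead sub-line with no open debt (census tribunal batch 1, TRIB-PNENP-ROOTDECOMP-1: «dead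
sub-line items 26298/26299 still open»).  0 sorry; no axioms beyond the route file's.
-/

namespace Summit.PneNP.PneNP.Theorems

/-- Glue of the N7 split (stmt-PneNP-26299): `SmallSegregators → SegregatorLift → EqExpRungLog`, by
modus ponens (`SegregatorLift` is by definition `SmallSegregators → EqExpRungLog`).
(decomp-pnenp cell, 2026-08-30.) -/
theorem eqExpRungLogGlue_proof :
    Summit.PneNP.PneNP.Theses.RootDecompSegregator.EqExpRungLogGlue := by
  unfold Summit.PneNP.PneNP.Theses.RootDecompSegregator.EqExpRungLogGlue
    Summit.PneNP.PneNP.Theses.RootDecompSegregator.SegregatorLift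
  intro hS hL
  exact hL hS

end Summit.PneNP.PneNP.Theorems
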